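/-
Copyright (c) 2026 the pub-hodgecm-mathlib formalisation cell (harness21).  Prover seat hodgecm-mathlib-K2Liu-p13 (g2), Track B «K2-LIT»,
#184♮ = hLiu418 = `stmt-HodgeConjecture-24832`; Road I v3 organ U1-CT-ind STAGE 2 (Q2), file F5-f (LEAD F0P6-plan (g14) 10:39:33Z ∕ 11:15:51Z «F4 → F5 → D-U1 stage 3 =»).
-/
import Summits.HodgeConjecture.HodgeConjecture.Theorems.K2LiuKlingenCellOneSum             -- ★ F5-b: `tsum_cellOne_eq_tsum`, `summable_cellOne_iff` (+ ★ F4-1c∕1f, F1)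
import Summits.HodgeConjecture.HodgeConjecture.Theorems.K2LiuKlingenUnipotentAdelicDefs     -- ★ F4-1: `jAdelic`, `adelicVal_jAdelic`
import Summits.HodgeConjecture.HodgeConjecture.Theorems.K2E1BorelEisensteinUDefs            -- ★ E1 (K2E1-p08 (g4)): `eisensteinSeriesU` (+ ★ `K2E1BruhatCosetsU`: `mem_borelU_iff_apply_eq_zero_two`)
import HarnessLib

/-!
# Crux `HLiu418`, Road I v3, organ U1 stage 2 (Q2), file F5-f: THE IDENTITY CELL OF THE Q-CONSTANT TERM IS E1's BOREL EISENSTEIN SERIES OF `U(J₂)` —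
# `Σ_{x ∈ C₁} f(γ_x · Ψ(m_Q(1,g₂)) · h) = eisensteinSeriesU (y ↦ f(Ψ(m_Q(1,y)) · h)) g₂`

Cell `hodgecm-mathlib`, crux item hLiu418 = `stmt-HodgeConjecture-24832`; squad K2 ∕ K2Liu; LEAD F0P6-plan (g14), co-dealer K2E5-plan (g7); prover K2Liu-p13 (g2).
THEOREMS ONLY (no `def`, no instance, no notation, no named-fact hypothesis, no `sorry`); lane `--supports stmt-HodgeConjecture-24832 --as helper` (count-neutral).
THE K2Liu ∕ K2E1 JUNCTION OF THE Q-CONSTANT TERM, term 1.  ★ F5-b `tsum_cellOne_eq_tsum` rewrote the identity cell `Σ_{x ∈ C₁} f(γ_x h)` over ANY row section of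
`B₂(L⁺)\U(J₂)(L⁺)`; E1's ★ `K2E1BorelEisensteinUDefs.eisensteinSeriesU f g = Σ'_{q : B(F)\G(F)} f(toAdelic (out q) · g)` sums over ★ `K2E1BruhatCosetsU`'s coset type
`Quotient (orbitRel ↥(borelU c J₂) ↥U(J₂)(L))` with the representatives `Quotient.out`.  THIS FILE takes THAT row section:
* §1 `coe_jAdelic_two_symm_toAdelic` (matrix of `(jAdelic 2)⁻¹(toAdelic g′) = g′.map ι`), **`jAdelic_klingenLevi_one_symm_toAdelic`** (`jAdelic₄ (m_Q^𝔸(1, (jAdelic 2)⁻¹(toAdelic g′))) =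
  toAdelic₄ (m_Q^L(1, g′))`: the rational and adelic Levi letters agree), `klingenLevi_one_mul` (`m_Q(1, u v) = m_Q(1,u) m_Q(1,v)` at `R`);
* §2 `borelU_out_cover`, `borelU_out_separate` — E1's `Quotient.out` IS a row section in ★ F5-b's sense (`(g′ (out ⟦g′⟧)⁻¹)₁₀ = 0`; `(out j (out i)⁻¹)₁₀ = 0 → i = j`, corner test
  ★ `mem_borelU_iff_apply_eq_zero_two`);
* §3 **`tsum_cellOne_eq_eisensteinSeriesU`**: for `h ∈ H(𝔸)` and `g₂ ∈ U(J₂)(𝔸_{L⁺})` (Mok's `(quasiSplit L⁺ L c 2).Adelic`),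
  `Σ'_{x ∈ C₁} f(γ_x · (Ψ(jAdelic₄ m_Q^𝔸(1, (jAdelic 2)⁻¹ g₂)) · h)) = eisensteinSeriesU (fun y ↦ f(Ψ(jAdelic₄ m_Q^𝔸(1, (jAdelic 2)⁻¹ y)) · h)) g₂`, and `summable_cellOne_iff_eisensteinU`
  — with ★ F5-d (`y ↦ f(Ψ(m_Q(1,y)) h)` is a Borel section of `U(J₂)(𝔸)` with character `χ(b₀₀)‖b₀₀‖^{s+1}`, E1 parameter `s + ½`) term 1 of `E_Q(Ψ(m_Q(1,g₂)) h)` is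
  `(∫β) · E^{U(J₂)}(i^*f_h)(g₂)`, E1's Borel Eisenstein series [MoeglinWaldspurger1995, II.1.7 (ii)].
[MoeglinWaldspurger1995, II.1.5, II.1.7], [Xiong2013, §7 Lemma 7.1], [Rogawski1990, §2.2], [Garrett2018, §3.10].
HONEST LABEL.  Count-neutral helper: `HC_CM` is proved only modulo the 7 printed citations (2 remaining named inputs: hLiu418 = `stmt-HodgeConjecture-24832`,
h413 = `stmt-HodgeConjecture-24833`) until rung 0 closes.
-/

set_option autoImplicit false
set_option linter.dupNamespace false -- the mandated namespace repeats `HodgeConjecture.HodgeConjecture`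

noncomputable section

open scoped Matrix
open NumberField IsDedekindDomain MulAction

namespace Summit.HodgeConjecture.HodgeConjecture.Cruxes.HLiu418.K2LiuKlingenCellOneEisensteinU

open Literature.NumberTheory.Automorphic Literature.NumberTheory.Automorphic.UnitaryGroup
open Literature.NumberTheory.GelbartRogawski1991 Literature.NumberTheory.GelbartRogawski1991.GRConstruction
open Literature.NumberTheory.GaloisRepresentations
open Literature.NumberTheory.K2Lit.SiegelDoubled
open Summit.HodgeConjecture.HodgeConjecture.Cruxes.HLiu418.K2LiuDoubledUTwoTwoBorelFrame
open Summit.HodgeConjecture.HodgeConjecture.Cruxes.HLiu418.K2LiuKlingenParabolicDefs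
open Summit.HodgeConjecture.HodgeConjecture.Cruxes.HLiu418.K2LiuKlingenUnipotentAdelicDefs
open Summit.HodgeConjecture.HodgeConjecture.Cruxes.HLiu418.K2LiuKlingenRationalCells (coe_adelicVal_toAdelic complexConj_ringHom_apply_apply)
open Summit.HodgeConjecture.HodgeConjecture.Cruxes.HLiu418.K2LiuKlingenCellOneConstant (coe_jAdelic_symm_toAdelic)
open Summit.HodgeConjecture.HodgeConjecture.Cruxes.HLiu418.K2LiuKlingenCellOneSum (tsum_cellOne_eq_tsum summable_cellOne_iff)
open Summit.HodgeConjecture.HodgeConjecture.Cruxes.HLiu418.K2LiuSiegelDoubledLeviMatrix (conjAdele_conjAdele')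
open Summit.HodgeConjecture.HodgeConjecture.Cruxes.H413.K2E1BorelEisensteinU (eisensteinSeriesU eisensteinSeriesU_def)
open Summit.HodgeConjecture.HodgeConjecture.Cruxes.H413.K2E1BruhatCosetsU (mem_borelU_iff_apply_eq_zero_two)
open UnitaryDualPair

variable {L : Type} [Field L] [NumberField L] [IsCMField L]
variable {N M : ℕ} {e : Fin N × Fin M ≃ Fin 2}
  {dV : Fin N → L} {hdV : ∀ i, IsCMField.complexConj L (dV i) = dV i}
  {dW : Fin M → L} {hdW : ∀ i, IsCMField.complexConj L (dW i) = dW i}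

section Transport

variable {SA : GL (Fin (2 + 2)) (AdeleRing (𝓞 L) L)}
  {Ψ : (quasiSplit (Fp L) L (IsCMField.complexConj L) (2 + 2)).Adelic ≃ₜ* HA L e dV hdV dW hdW} {X Y : Matrix (Fin 2) (Fin 2) (Fp L)} {a : Fp L}
  (hΨ : ∀ g : (quasiSplit (Fp L) L (IsCMField.complexConj L) (2 + 2)).Adelic,
    (((Ψ g : HA L e dV hdV dW hdW) : GL (Fin (2 + 2)) (AdeleRing (𝓞 L) L)) : Matrix (Fin (2 + 2)) (Fin (2 + 2)) (AdeleRing (𝓞 L) L)) =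
      (SA : Matrix (Fin (2 + 2)) (Fin (2 + 2)) (AdeleRing (𝓞 L) L)) *
        ((adelicVal (Fp L) L (IsCMField.complexConj L) (2 + 2) _ g : GL (Fin (2 + 2)) (AdeleRing (𝓞 L) L)) :
          Matrix (Fin (2 + 2)) (Fin (2 + 2)) (AdeleRing (𝓞 L) L)) *
        ((SA⁻¹ : GL (Fin (2 + 2)) (AdeleRing (𝓞 L) L)) : Matrix (Fin (2 + 2)) (Fin (2 + 2)) (AdeleRing (𝓞 L) L)))
  (ha : a + a = 1)
  (hSA : Matrix.reindex (e₂ (n := 2)).symm (e₂ (n := 2)).symm (SA : Matrix (Fin (2 + 2)) (Fin (2 + 2)) (AdeleRing (𝓞 L) L)) =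
    Matrix.fromBlocks (1 : Matrix (Fin 2) (Fin 2) (AdeleRing (𝓞 L) L)) (X.map ((algebraMap L (AdeleRing (𝓞 L) L)).comp (algebraMap (Fp L) L))) 1
      (-(X.map ((algebraMap L (AdeleRing (𝓞 L) L)).comp (algebraMap (Fp L) L)))))
  (hSAi : Matrix.reindex (e₂ (n := 2)).symm (e₂ (n := 2)).symm ((SA⁻¹ : GL (Fin (2 + 2)) (AdeleRing (𝓞 L) L)) : Matrix (Fin (2 + 2)) (Fin (2 + 2)) (AdeleRing (𝓞 L) L)) =
    Matrix.fromBlocks ((a • (1 : Matrix (Fin 2) (Fin 2) (Fp L))).map ((algebraMap L (AdeleRing (𝓞 L) L)).comp (algebraMap (Fp L) L)))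
      ((a • (1 : Matrix (Fin 2) (Fin 2) (Fp L))).map ((algebraMap L (AdeleRing (𝓞 L) L)).comp (algebraMap (Fp L) L)))
      (Y.map ((algebraMap L (AdeleRing (𝓞 L) L)).comp (algebraMap (Fp L) L)))
      (-(Y.map ((algebraMap L (AdeleRing (𝓞 L) L)).comp (algebraMap (Fp L) L)))))
  (hXY : X * Y = a • (1 : Matrix (Fin 2) (Fin 2) (Fp L))) (hYX : Y * X = a • (1 : Matrix (Fin 2) (Fin 2) (Fp L)))

/-! ## §1 Rational versus adelic Klingen Levi letters -/

/-- `m_Q(1, u v) = m_Q(1, u) · m_Q(1, v)` (★ F1 `klingenLevi_mul` at `a = a′ = 1`). [cite: Xiong2013, §7 Lemma 7.1] -/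
theorem klingenLevi_one_mul {R : Type*} [CommRing R] {σ : R →+* R} (hσ : ∀ x, σ (σ x) = x) (u v : unitaryGroupOfForm σ ((StdForm.antidiagonal 2).over R)) :
    klingenLevi R σ hσ 1 (u * v) = klingenLevi R σ hσ 1 u * klingenLevi R σ hσ 1 v := by
  rw [klingenLevi_mul, mul_one]

/-- the matrix of `(jAdelic 2)⁻¹ (toAdelic g′)` is `g′.map (L ↪ 𝔸_L)`. [cite: Mok2014, §1 Notation p. 5] -/
theorem coe_jAdelic_two_symm_toAdelic (g' : unitaryGroupOfForm ((IsCMField.complexConj L : L ≃ₐ[Fp L] L) : L →+* L) ((StdForm.antidiagonal 2).over L)) :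
    ((((jAdelic L 2).symm (UnitaryGroup.toAdelic (Fp L) L (IsCMField.complexConj L) 2 ((StdForm.antidiagonal 2).over L) g') :
        unitaryGroupOfForm (conjAdele (Fp L) L (IsCMField.complexConj L)) ((StdForm.antidiagonal 2).over (AdeleRing (𝓞 L) L))) :
        GL (Fin 2) (AdeleRing (𝓞 L) L)) : Matrix (Fin 2) (Fin 2) (AdeleRing (𝓞 L) L)) =
      ((g' : GL (Fin 2) L) : Matrix (Fin 2) (Fin 2) L).map (algebraMap L (AdeleRing (𝓞 L) L)) := by
  rw [← coe_adelicVal_jAdelic L 2 ((jAdelic L 2).symm (UnitaryGroup.toAdelic (Fp L) L (IsCMField.complexConj L) 2 ((StdForm.antidiagonal 2).over L) g')),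
    MulEquiv.apply_symm_apply, coe_adelicVal_toAdelic L 2 g']

/-- **the rational and the adelic Klingen Levi letters agree**: `jAdelic₄ (m_Q^𝔸(1, (jAdelic 2)⁻¹(toAdelic g′))) = toAdelic₄ (m_Q^L(1, g′))`.
[cite: Xiong2013, §7 Lemma 7.1] [cite: Mok2014, §1 Notation p. 5] -/
theorem jAdelic_klingenLevi_one_symm_toAdelic (g' : unitaryGroupOfForm ((IsCMField.complexConj L : L ≃ₐ[Fp L] L) : L →+* L) ((StdForm.antidiagonal 2).over L)) :
    jAdelic L 4 (klingenLevi (AdeleRing (𝓞 L) L) (conjAdele (Fp L) L (IsCMField.complexConj L)) (conjAdele_conjAdele' L) 1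
        ((jAdelic L 2).symm (UnitaryGroup.toAdelic (Fp L) L (IsCMField.complexConj L) 2 ((StdForm.antidiagonal 2).over L) g'))) =
      UnitaryGroup.toAdelic (Fp L) L (IsCMField.complexConj L) (2 + 2) ((StdForm.antidiagonal (2 + 2)).over L)
        (klingenLevi L ((IsCMField.complexConj L : L ≃ₐ[Fp L] L) : L →+* L) (complexConj_ringHom_apply_apply L) 1 g') := by
  rw [← (jAdelic L 4).apply_symm_apply (UnitaryGroup.toAdelic (Fp L) L (IsCMField.complexConj L) (2 + 2) ((StdForm.antidiagonal (2 + 2)).over L)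
    (klingenLevi L ((IsCMField.complexConj L : L ≃ₐ[Fp L] L) : L →+* L) (complexConj_ringHom_apply_apply L) 1 g'))]
  congr 1
  apply ext_of_coe
  rw [coe_klingenLevi, coe_jAdelic_symm_toAdelic, coe_klingenLevi]
  ext i j
  have h2 := coe_jAdelic_two_symm_toAdelic g'
  fin_cases i <;> fin_cases j <;> simp [klingenLeviM, Matrix.map_apply, h2]

/-! ## §2 E1's `Quotient.out` is a row section of `B₂(L⁺)\U(J₂)(L⁺)` -/

/-- every `g′` meets the row of `out ⟦g′⟧`: `(g′ · (out ⟦g′⟧)⁻¹)₁₀ = 0`. [cite: Rogawski1990, §1.10 p. 9] [cite: Garrett2018, §2.10] -/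
theorem borelU_out_cover (g' : unitaryGroupOfForm ((IsCMField.complexConj L : L ≃ₐ[Fp L] L) : L →+* L) ((StdForm.antidiagonal 2).over L)) :
    (((g' * (Quotient.out (Quotient.mk (orbitRel ↥(borelU ((IsCMField.complexConj L : L ≃ₐ[Fp L] L) : L →+* L) ((StdForm.antidiagonal 2).over L))
        ↥(unitaryGroupOfForm ((IsCMField.complexConj L : L ≃ₐ[Fp L] L) : L →+* L) ((StdForm.antidiagonal 2).over L))) g'))⁻¹ :
        unitaryGroupOfForm ((IsCMField.complexConj L : L ≃ₐ[Fp L] L) : L →+* L) ((StdForm.antidiagonal 2).over L)) : GL (Fin 2) L) : Matrix (Fin 2) (Fin 2) L) 1 0 = 0 := by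
  obtain ⟨b, hb⟩ := mem_orbit_iff.1 (Quotient.mk_out (s := orbitRel ↥(borelU ((IsCMField.complexConj L : L ≃ₐ[Fp L] L) : L →+* L) ((StdForm.antidiagonal 2).over L))
    ↥(unitaryGroupOfForm ((IsCMField.complexConj L : L ≃ₐ[Fp L] L) : L →+* L) ((StdForm.antidiagonal 2).over L))) g')
  rw [← hb, Subgroup.smul_def, smul_eq_mul, _root_.mul_inv_rev, mul_inv_cancel_left]
  exact (mem_borelU_iff_apply_eq_zero_two _ _).1 (inv_mem b.2)

/-- distinct cosets have separated rows: `(out j · (out i)⁻¹)₁₀ = 0 → i = j`. [cite: Rogawski1990, §1.10 p. 9] [cite: Garrett2018, §2.10] -/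
theorem borelU_out_separate (i j : Quotient (orbitRel ↥(borelU ((IsCMField.complexConj L : L ≃ₐ[Fp L] L) : L →+* L) ((StdForm.antidiagonal 2).over L))
      ↥(unitaryGroupOfForm ((IsCMField.complexConj L : L ≃ₐ[Fp L] L) : L →+* L) ((StdForm.antidiagonal 2).over L))))
    (hij : (((Quotient.out j * (Quotient.out i)⁻¹ : unitaryGroupOfForm ((IsCMField.complexConj L : L ≃ₐ[Fp L] L) : L →+* L) ((StdForm.antidiagonal 2).over L)) :
      GL (Fin 2) L) : Matrix (Fin 2) (Fin 2) L) 1 0 = 0) : i = j := by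
  have hb := (mem_borelU_iff_apply_eq_zero_two _ _).2 hij
  rw [← Quotient.out_eq i, ← Quotient.out_eq j]
  refine (Quotient.sound ?_).symm
  change Quotient.out j ∈ orbit _ (Quotient.out i)
  exact mem_orbit_iff.2 ⟨⟨_, hb⟩, by rw [Subgroup.smul_def, smul_eq_mul, Subgroup.coe_mk, inv_mul_cancel_right]⟩

/-! ## §3 The identity cell as E1's Borel Eisenstein series -/

include hΨ ha hSA hSAi hXY hYX in
/-- **(Q2) F5-f — TERM 1 OF THE Q-CONSTANT TERM IS E1's BOREL EISENSTEIN SERIES OF `U(J₂)`.**  For `h ∈ H(𝔸)` and `g₂ ∈ U(J₂)(𝔸_{L⁺})`: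
  `Σ'_{x ∈ C₁} f(γ_x · (Ψ(jAdelic₄ m_Q^𝔸(1, (jAdelic 2)⁻¹ g₂)) · h)) = eisensteinSeriesU (y ↦ f(Ψ(jAdelic₄ m_Q^𝔸(1, (jAdelic 2)⁻¹ y)) · h)) g₂`
(★ F5-b over E1's row section `Quotient.out`, §2; termwise `m_Q(1, γ g₂) = m_Q(1,γ) m_Q(1,g₂)` and §1).  With ★ F5-d the section `y ↦ f(Ψ(m_Q(1,y)) h)` is a Borel section of
`U(J₂)(𝔸)` at E1's parameter `s + ½`: term 1 of `E_Q` along the Klingen Levi is `(∫β) · E^{U(J₂)}(i^*f_h)`. [cite: MoeglinWaldspurger1995, II.1.7] [cite: Rogawski1990, §2.2] -/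
theorem tsum_cellOne_eq_eisensteinSeriesU (C₁ : Set (SiegelDeltaQuot L e dV hdV dW hdW))
    (hC₁ : ∀ x, x ∈ C₁ ↔ ∃ q ∈ klingen L ((IsCMField.complexConj L : L ≃ₐ[Fp L] L) : L →+* L), ∃ γ : ratH L e dV hdV dW hdW,
      (γ : HA L e dV hdV dW hdW) = Ψ (UnitaryGroup.toAdelic (Fp L) L (IsCMField.complexConj L) (2 + 2) ((StdForm.antidiagonal (2 + 2)).over L) q) ∧
        x = Quotient.mk (MulAction.orbitRel (siegelDeltaRat L e dV hdV dW hdW) (ratH L e dV hdV dW hdW)) γ)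
    {χ : HeckeCharacter L} {s : ℂ} {f : HA L e dV hdV dW hdW → ℂ} (hf : IsSiegelDeltaSection L e dV hdV dW hdW χ s f) (h : HA L e dV hdV dW hdW)
    (g₂ : (quasiSplit (Fp L) L (IsCMField.complexConj L) 2).Adelic) :
    ∑' x : C₁, f ((((Quotient.out (x : SiegelDeltaQuot L e dV hdV dW hdW) : ratH L e dV hdV dW hdW) : HA L e dV hdV dW hdW)) *
        (Ψ (jAdelic L 4 (klingenLevi (AdeleRing (𝓞 L) L) (conjAdele (Fp L) L (IsCMField.complexConj L)) (conjAdele_conjAdele' L) 1 ((jAdelic L 2).symm g₂))) * h)) =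
      eisensteinSeriesU (fun y : (quasiSplit (Fp L) L (IsCMField.complexConj L) 2).Adelic =>
        f (Ψ (jAdelic L 4 (klingenLevi (AdeleRing (𝓞 L) L) (conjAdele (Fp L) L (IsCMField.complexConj L)) (conjAdele_conjAdele' L) 1 ((jAdelic L 2).symm y))) * h)) g₂ := by
  rw [tsum_cellOne_eq_tsum hΨ ha hSA hSAi hXY hYX C₁ hC₁ (fun q => Quotient.out q) (fun g' => ⟨_, borelU_out_cover g'⟩) borelU_out_separate hf _, eisensteinSeriesU_def]
  refine tsum_congr fun q => ?_
  -- `m_Q(1, (j₂⁻¹)(toAdelic γ · g₂)) = m_Q(1, j₂⁻¹(toAdelic γ)) · m_Q(1, j₂⁻¹ g₂)` and §1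
  change f _ = f (Ψ (jAdelic L 4 (klingenLevi (AdeleRing (𝓞 L) L) (conjAdele (Fp L) L (IsCMField.complexConj L)) (conjAdele_conjAdele' L) 1
    ((jAdelic L 2).symm ((quasiSplit (Fp L) L (IsCMField.complexConj L) 2).toAdelic (Quotient.out q) * g₂)))) * h)
  have hq : (quasiSplit (Fp L) L (IsCMField.complexConj L) 2).toAdelic (Quotient.out q) =
      UnitaryGroup.toAdelic (Fp L) L (IsCMField.complexConj L) 2 ((StdForm.antidiagonal 2).over L) (Quotient.out q) := rfl
  rw [hq, map_mul (jAdelic L 2).symm, klingenLevi_one_mul, map_mul, jAdelic_klingenLevi_one_symm_toAdelic, map_mul, mul_assoc]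
  rfl

include hΨ ha hSA hSAi hXY hYX in
/-- **… with the summability transferred**: the E1 series converges (absolutely, termwise over the cosets) iff the identity cell does. [cite: MoeglinWaldspurger1995, II.1.7] -/
theorem summable_cellOne_iff_eisensteinU (C₁ : Set (SiegelDeltaQuot L e dV hdV dW hdW))
    (hC₁ : ∀ x, x ∈ C₁ ↔ ∃ q ∈ klingen L ((IsCMField.complexConj L : L ≃ₐ[Fp L] L) : L →+* L), ∃ γ : ratH L e dV hdV dW hdW,
      (γ : HA L e dV hdV dW hdW) = Ψ (UnitaryGroup.toAdelic (Fp L) L (IsCMField.complexConj L) (2 + 2) ((StdForm.antidiagonal (2 + 2)).over L) q) ∧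
        x = Quotient.mk (MulAction.orbitRel (siegelDeltaRat L e dV hdV dW hdW) (ratH L e dV hdV dW hdW)) γ)
    {χ : HeckeCharacter L} {s : ℂ} {f : HA L e dV hdV dW hdW → ℂ} (hf : IsSiegelDeltaSection L e dV hdV dW hdW χ s f) (h : HA L e dV hdV dW hdW)
    (g₂ : (quasiSplit (Fp L) L (IsCMField.complexConj L) 2).Adelic) :
    Summable (fun q : Quotient (orbitRel ↥(borelU ((IsCMField.complexConj L : L ≃ₐ[Fp L] L) : L →+* L) ((StdForm.antidiagonal 2).over L))
        ↥(unitaryGroupOfForm ((IsCMField.complexConj L : L ≃ₐ[Fp L] L) : L →+* L) ((StdForm.antidiagonal 2).over L))) =>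
      f (Ψ (jAdelic L 4 (klingenLevi (AdeleRing (𝓞 L) L) (conjAdele (Fp L) L (IsCMField.complexConj L)) (conjAdele_conjAdele' L) 1
        ((jAdelic L 2).symm ((quasiSplit (Fp L) L (IsCMField.complexConj L) 2).toAdelic (Quotient.out q) * g₂)))) * h)) ↔
    Summable (fun x : C₁ => f ((((Quotient.out (x : SiegelDeltaQuot L e dV hdV dW hdW) : ratH L e dV hdV dW hdW) : HA L e dV hdV dW hdW)) *
        (Ψ (jAdelic L 4 (klingenLevi (AdeleRing (𝓞 L) L) (conjAdele (Fp L) L (IsCMField.complexConj L)) (conjAdele_conjAdele' L) 1 ((jAdelic L 2).symm g₂))) * h))) := by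
  rw [← summable_cellOne_iff hΨ ha hSA hSAi hXY hYX C₁ hC₁ (fun q => Quotient.out q) (fun g' => ⟨_, borelU_out_cover g'⟩) borelU_out_separate hf _]
  refine Iff.of_eq (congrArg Summable (funext fun q => ?_))
  have hq : (quasiSplit (Fp L) L (IsCMField.complexConj L) 2).toAdelic (Quotient.out q) =
      UnitaryGroup.toAdelic (Fp L) L (IsCMField.complexConj L) 2 ((StdForm.antidiagonal 2).over L) (Quotient.out q) := rfl
  rw [hq, map_mul (jAdelic L 2).symm, klingenLevi_one_mul, map_mul, jAdelic_klingenLevi_one_symm_toAdelic, map_mul, mul_assoc]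
  rfl

end Transport

end Summit.HodgeConjecture.HodgeConjecture.Cruxes.HLiu418.K2LiuKlingenCellOneEisensteinU

end
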